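import Summits.QuantumFields.YangMills.Theorems.SwapVirialDeficitSectorLaplaceMbDensityPointwise
import Summits.QuantumFields.YangMills.Theorems.SwapVirialDeficitGnomonicTaylorFour
import HarnessLib

/-!
# E1, model part 1: THE RESCALED (x₀-UNIFORM) FIBRE LETTERS of the gnomonic chart — `y_x = u/√(1+x₀²)`, `y_y = v/√(1+y₀²)`
# (free-hands support of ⟨stmt-QuantumFields-24197⟩ `SwapVirialDeficit.SwapGluedStiffness` ∕ ⟨24194⟩; w2 g59 STATUS 2026-08-31T18:27Z «E1»)

At the base point `gnoBase x₀ y₀` the natural transverse letters of the free leaders are the NORMALISED ones: fcl-p3 g47's ✓`taylor_four_gnoDeficit` bounds the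
Euler-ray jets with the sizes `√((η_x1²+η_x2²)/(1+η_x0²))`, and the gnomonic density FACTORISES, `ρ(gnoBase p + ξ(D_p y)) = ρ(gnoBase p)·ρ(ξ(y))`, for the diagonal
weight `D_p = (√(1+x₀²) on x_⊥, √(1+y₀²) on y_⊥, 1 on z and the followers)`.  So in the letters `y ↦ gnoFibreEquiv (p, gnoScale p y)` the cubic datum and the
amplitude of the bulk fibred Laplace step are UNIFORM in `p ∈ ℝ²` — no gnomonic-end cut `|x₀|, |y₀| ≤ V₀` is needed for them (the uniform coercivity needs w3 g66's
BLOCKWISE ray floor and is not here).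

* §1 `gnoFibreScale p : GnoFibreIdx L → ℝ` (the weight), `gnoScale p y` (the rescaled fibre vector), `gnoScaleLin p` (as a linear map); `gnoFibreScale_pos`,
  `gnoScale_apply`, `gnoScale_smul`, `measurable_gnoScale_prod`;
* §2 the rescaled chart point `gnoFibreEquiv (p, gnoScale p y)`: ★ `eulerDilate_gnoFibreEquiv` (`eulerDilate t (gnoFibreEquiv (p, y)) = gnoFibreEquiv (p, t • y)` — the
  Euler ray IS the fibre ray), `letterSizes_rescaled_le` (all four NORMALISED letter sizes of the rescaled point are `≤ ‖y‖`);
* §3 ★★ `rescaled_ray_jets` (g47's jets along `t ↦ F̂(gnoBase p + t·gnoFibreEmb (gnoScale p y))` with `A = ‖y‖`, uniform in `p`), ★★ `rescaled_cubic_flat`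
  (`|F̂(gnoFibreEquiv (p, gnoScale p y)) − ½·fibQ a ε p (gnoScale p y)| ≤ 1242000L⁴‖y‖³` at the flat base, EVERY `p`, principal sector);
* §4 ★★ `gnoDensity_rescaled_eq` (`ρ(gnoFibreEquiv (p, gnoScale p y)) = ρ(gnoBase p)·ρ(gnoFibreEmb y)`), `gnoDensity_gnoFibreEmb_bounds` (`1 − 2‖y‖² ≤ ρ(gnoFibreEmb y) ≤ 1`),
  `gnoDensity_gnoBase_mul_jacobian` (`ρ(gnoBase p)·(1+x₀²)(1+y₀²) = (1+x₀²)⁻¹(1+y₀²)⁻¹`).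

HONEST LABEL: definitions + algebra on landed results; ⟨24197⟩ ∕ ⟨24194⟩ (window-uniform) OPEN; own crux ⟨22884⟩ OPEN (blocked-on ⟨19935⟩); no crux, rung of record or summit is
proved; the Yang–Mills mass gap is NOT proved; no summit is proved by a line.  Width seat ym-line-sfw-p2-w2 g59 (cell ym-idea-1, free hands), `--supports stmt-QuantumFields-24197`.
Three `def`s, theorems otherwise, 0 `sorry`, standard axioms.  References: [cite: Luscher1983, §2]; [folklore].
-/

set_option autoImplicit false
set_option synthInstance.maxSize 1024

noncomputable section

open MeasureTheory Quaternion Set Module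
open scoped Quaternion BigOperators ENNReal InnerProductSpace
open Literature.MathematicalPhysics.QuantumLattice
open Literature.MathematicalPhysics.QuantumFieldTheory hiding SU2

namespace Summit.QuantumFields.YangMills.Theorems.SwapVirialDeficit.BlowUpRing

open Summit.QuantumFields.YangMills.Theorems.FemtoTransferGap
open Summit.QuantumFields.YangMills.Theorems.FemtoTransferGap.TT
open Summit.QuantumFields.YangMills.Theorems.VirialFluxGap.RingDeficit
open Summit.QuantumFields.YangMills.Theorems.SwapVirialDeficit.SwapRing
open Summit.QuantumFields.YangMills.Theorems.SwapVirialDeficit.SectorLaplace (fibQ z₀)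
open Summit.QuantumFields.YangMills.Theorems.SwapVirialDeficit.Gnomonic (normSq3 normSq3_nonneg gnomonicWeight piWeight gnomonicWeight_pos taylor_four_gnoDeficit)

variable {L : ℕ} [NeZero L]

/-! ## §1 The weight and the rescaled fibre vector -/

/-- THE RESCALING WEIGHT at the base point `p = (x₀, y₀)`: `√(1+x₀²)` on the two `x_⊥` letters, `√(1+y₀²)` on the two `y_⊥` letters, `1` on `z` and the followers. [folklore] -/
def gnoFibreScale (p : ℝ × ℝ) : GnoFibreIdx L → ℝ :=
  Sum.elim (Sum.elim (fun _ : Fin 2 => Real.sqrt (1 + p.1 ^ 2)) (fun _ : Fin 2 => Real.sqrt (1 + p.2 ^ 2))) (Sum.elim (fun _ : Fin 3 => (1 : ℝ)) (fun _ : Fol L × Fin 3 => (1 : ℝ)))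

/-- THE RESCALED FIBRE VECTOR `gnoScale p y = (gnoFibreScale p i · y_i)_i`. [folklore] -/
def gnoScale (p : ℝ × ℝ) (y : GnoFibre L) : GnoFibre L := WithLp.toLp 2 fun i => gnoFibreScale (L := L) p i * y i

/-- The rescaling as a linear map of the fibre. [folklore] -/
def gnoScaleLin (p : ℝ × ℝ) : GnoFibre L →ₗ[ℝ] GnoFibre L where
  toFun := gnoScale p
  map_add' y y' := PiLp.ext fun i => by simp only [gnoScale, PiLp.toLp_apply, PiLp.add_apply]; ring
  map_smul' c y := PiLp.ext fun i => by simp only [gnoScale, PiLp.toLp_apply, PiLp.smul_apply, smul_eq_mul, RingHom.id_apply]; ring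

omit [NeZero L] in
/-- Every weight is positive. [folklore] -/
theorem gnoFibreScale_pos (p : ℝ × ℝ) (i : GnoFibreIdx L) : 0 < gnoFibreScale (L := L) p i := by
  rcases i with ((j | j) | (k | fk))
  · exact Real.sqrt_pos.2 (by positivity)
  · exact Real.sqrt_pos.2 (by positivity)
  · exact one_pos
  · exact one_pos

omit [NeZero L] in
/-- Coordinates of the rescaled vector. [folklore] -/
theorem gnoScale_apply (p : ℝ × ℝ) (y : GnoFibre L) (i : GnoFibreIdx L) : gnoScale p y i = gnoFibreScale (L := L) p i * y i := rfl

omit [NeZero L] in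
/-- The rescaling commutes with scalars. [folklore] -/
theorem gnoScale_smul (p : ℝ × ℝ) (t : ℝ) (y : GnoFibre L) : gnoScale p (t • y) = t • gnoScale p y :=
  PiLp.ext fun i => by simp only [gnoScale, PiLp.toLp_apply, PiLp.smul_apply, smul_eq_mul]; ring

omit [NeZero L] in
/-- The weights are measurable in the base point. [folklore] -/
theorem measurable_gnoFibreScale (i : GnoFibreIdx L) : Measurable fun p : ℝ × ℝ => gnoFibreScale (L := L) p i := by
  rcases i with ((j | j) | (k | fk))
  · exact (measurable_const.add (measurable_fst.pow_const 2)).sqrt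
  · exact (measurable_const.add (measurable_snd.pow_const 2)).sqrt
  · exact measurable_const
  · exact measurable_const

omit [NeZero L] in
/-- `(p, y) ↦ gnoScale p y` is jointly measurable. [folklore] -/
theorem measurable_gnoScale_prod : Measurable fun q : (ℝ × ℝ) × GnoFibre L => gnoScale (L := L) q.1 q.2 := by
  refine (WithLp.measurable_toLp 2 _).comp (measurable_pi_lambda _ fun i => ?_)
  exact ((measurable_gnoFibreScale i).comp measurable_fst).mul ((measurable_pi_apply i).comp ((WithLp.measurable_ofLp 2 _).comp measurable_snd))

/-! ## §2 The rescaled chart point and its letters -/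

/-- ★ **THE EULER RAY IS THE FIBRE RAY**: `eulerDilate t (gnoFibreEquiv (p, y)) = gnoFibreEquiv (p, t • y)`. [folklore] -/
theorem eulerDilate_gnoFibreEquiv (t : ℝ) (p : ℝ × ℝ) (y : GnoFibre L) : eulerDilate t (gnoFibreEquiv (p, y)) = gnoFibreEquiv (p, t • y) := by
  rw [gnoFibreEquiv_apply', gnoFibreEquiv_apply']
  simp only [eulerDilate, trDil, PiLp.smul_apply, smul_eq_mul, Matrix.cons_val_zero, Matrix.cons_val_one, Matrix.cons_val_two, Matrix.head_cons, Matrix.tail_cons]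
  refine Prod.ext (Prod.ext ?_ ?_) (Prod.ext ?_ ?_)
  · funext k; fin_cases k <;> rfl
  · funext k; fin_cases k <;> rfl
  · funext k; simp [Pi.smul_apply, smul_eq_mul]
  · funext f k; simp [Pi.smul_apply, smul_eq_mul]

/-- The ray through the rescaled point: `gnoBase p + t·gnoFibreEmb (gnoScale p y) = eulerDilate t (gnoFibreEquiv (p, gnoScale p y))`. [folklore] -/
theorem gnoBase_add_smul_eq_eulerDilate (t : ℝ) (p : ℝ × ℝ) (y : GnoFibre L) :
    gnoBase p.1 p.2 + t • gnoFibreEmb (gnoScale p y) = eulerDilate t (gnoFibreEquiv (p, gnoScale p y)) := by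
  rw [eulerDilate_gnoFibreEquiv, gnoFibreEquiv_apply, map_smul]

/-- The squared normalised size of the rescaled `x`-letter is `y_{x1}² + y_{x2}²`, and likewise for `y`. [folklore] -/
theorem normalised_letterSq_rescaled (p : ℝ × ℝ) (y : GnoFibre L) :
    ((gnoFibreEquiv (p, gnoScale p y)).1.1 1 ^ 2 + (gnoFibreEquiv (p, gnoScale p y)).1.1 2 ^ 2) / (1 + (gnoFibreEquiv (p, gnoScale p y)).1.1 0 ^ 2) =
        y (Sum.inl (Sum.inl 0)) ^ 2 + y (Sum.inl (Sum.inl 1)) ^ 2 ∧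
      ((gnoFibreEquiv (p, gnoScale p y)).1.2 1 ^ 2 + (gnoFibreEquiv (p, gnoScale p y)).1.2 2 ^ 2) / (1 + (gnoFibreEquiv (p, gnoScale p y)).1.2 0 ^ 2) =
        y (Sum.inl (Sum.inr 0)) ^ 2 + y (Sum.inl (Sum.inr 1)) ^ 2 := by
  rw [gnoFibreEquiv_apply']
  simp only [Matrix.cons_val_zero, Matrix.cons_val_one, Matrix.cons_val_two, Matrix.head_cons, Matrix.tail_cons, gnoScale_apply, gnoFibreScale,
    Sum.elim_inl, Sum.elim_inr]
  have hx : Real.sqrt (1 + p.1 ^ 2) ^ 2 = 1 + p.1 ^ 2 := Real.sq_sqrt (by positivity)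
  have hy : Real.sqrt (1 + p.2 ^ 2) ^ 2 = 1 + p.2 ^ 2 := Real.sq_sqrt (by positivity)
  have hx0 : (0 : ℝ) < 1 + p.1 ^ 2 := by positivity
  have hy0 : (0 : ℝ) < 1 + p.2 ^ 2 := by positivity
  constructor
  · rw [mul_pow, mul_pow, hx]; field_simp
  · rw [mul_pow, mul_pow, hy]; field_simp

/-- ★ **NORMALISED LETTER SIZES OF THE RESCALED POINT ARE `≤ ‖y‖`** — the `hx hy hz hf` of ✓`taylor_four_gnoDeficit` with `A := ‖y‖`, UNIFORMLY in `p`. [folklore] -/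
theorem letterSizes_rescaled_le (p : ℝ × ℝ) (y : GnoFibre L) :
    Real.sqrt (((gnoFibreEquiv (p, gnoScale p y)).1.1 1 ^ 2 + (gnoFibreEquiv (p, gnoScale p y)).1.1 2 ^ 2) / (1 + (gnoFibreEquiv (p, gnoScale p y)).1.1 0 ^ 2)) ≤ ‖y‖ ∧
    Real.sqrt (((gnoFibreEquiv (p, gnoScale p y)).1.2 1 ^ 2 + (gnoFibreEquiv (p, gnoScale p y)).1.2 2 ^ 2) / (1 + (gnoFibreEquiv (p, gnoScale p y)).1.2 0 ^ 2)) ≤ ‖y‖ ∧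
    Real.sqrt (∑ k, (gnoFibreEquiv (p, gnoScale p y)).2.1 k ^ 2) ≤ ‖y‖ ∧
    ∀ i, Real.sqrt (∑ k, (gnoFibreEquiv (p, gnoScale p y)).2.2 i k ^ 2) ≤ ‖y‖ := by
  obtain ⟨ex, ey⟩ := normalised_letterSq_rescaled p y
  have hn : 0 ≤ ‖y‖ := norm_nonneg _
  have hN := norm_sq_gnoFibre y
  have hbl : ∀ j, (gnoFibreBlocks y).1.1 j = y (Sum.inl (Sum.inl j)) := fun j => rfl
  have hbl' : ∀ j, (gnoFibreBlocks y).1.2 j = y (Sum.inl (Sum.inr j)) := fun j => rfl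
  have h0 : 0 ≤ (gnoFibreBlocks y).1.1 0 ^ 2 + (gnoFibreBlocks y).1.1 1 ^ 2 := by positivity
  have h1 : 0 ≤ (gnoFibreBlocks y).1.2 0 ^ 2 + (gnoFibreBlocks y).1.2 1 ^ 2 := by positivity
  have h2 : 0 ≤ normSq3 (gnoFibreBlocks y).2.1 := normSq3_nonneg _
  have h3 : 0 ≤ ∑ f, normSq3 ((gnoFibreBlocks y).2.2 f) := Finset.sum_nonneg fun f _ => normSq3_nonneg _
  -- the `z` and follower letters of the rescaled point are those of `y` (weight `1`)
  have ez : ∑ k, (gnoFibreEquiv (p, gnoScale p y)).2.1 k ^ 2 = normSq3 (gnoFibreBlocks y).2.1 := by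
    rw [gnoFibreEquiv_apply']
    simp only [gnoScale_apply, gnoFibreScale, Sum.elim_inr, Sum.elim_inl, one_mul, gnoFibreBlocks, normSq3]
  have ef : ∀ i, ∑ k, (gnoFibreEquiv (p, gnoScale p y)).2.2 i k ^ 2 = normSq3 ((gnoFibreBlocks y).2.2 i) := fun i => by
    rw [gnoFibreEquiv_apply']
    simp only [gnoScale_apply, gnoFibreScale, Sum.elim_inr, one_mul, gnoFibreBlocks, normSq3]
  refine ⟨?_, ?_, ?_, fun i => ?_⟩
  · rw [ex, ← Real.sqrt_sq hn]; refine Real.sqrt_le_sqrt ?_; rw [hN, hbl, hbl]; linarith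
  · rw [ey, ← Real.sqrt_sq hn]; refine Real.sqrt_le_sqrt ?_; rw [hN, hbl', hbl']; linarith
  · rw [ez, ← Real.sqrt_sq hn]; refine Real.sqrt_le_sqrt ?_; rw [hN]; linarith
  · rw [ef i, ← Real.sqrt_sq hn]; refine Real.sqrt_le_sqrt ?_; rw [hN]
    have : normSq3 ((gnoFibreBlocks y).2.2 i) ≤ ∑ f, normSq3 ((gnoFibreBlocks y).2.2 f) :=
      Finset.single_le_sum (f := fun f => normSq3 ((gnoFibreBlocks y).2.2 f)) (fun f _ => normSq3_nonneg _) (Finset.mem_univ i)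
    linarith

/-! ## §3 The rescaled jets and the cubic datum, uniform in the base point -/

/-- ★★ **g47's JETS ALONG THE RESCALED RAY**, uniform in `p`: with `ψ t = F̂(gnoBase p + t·gnoFibreEmb (gnoScale p y))`, `|ψ‴ t| ≤ 2484000L⁴‖y‖³`,
`|ψ⁗ t| ≤ 381240000L⁴‖y‖⁴` for all `t`, and `|F̂(gnoFibreEquiv (p, gnoScale p y)) − F̂(gnoBase p) − ψ′ 0 − ψ″ 0/2| ≤ 2484000L⁴‖y‖³/2`. [cite: Luscher1983, §2] -/
theorem rescaled_ray_jets (z : Fin 3 → Bool) (χ : Site 3 L → SU2) {a : ℍ} (ha : a ≠ 0) (ε : GnoSign L) (p : ℝ × ℝ) (y : GnoFibre L) :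
    (∀ t, |iteratedDeriv 3 (fun t : ℝ => gnoDeficit z χ a ε (gnoBase p.1 p.2 + t • gnoFibreEmb (gnoScale p y))) t| ≤ 2484000 * (L : ℝ) ^ 4 * ‖y‖ ^ 3 ∧
        |iteratedDeriv 4 (fun t : ℝ => gnoDeficit z χ a ε (gnoBase p.1 p.2 + t • gnoFibreEmb (gnoScale p y))) t| ≤ 381240000 * (L : ℝ) ^ 4 * ‖y‖ ^ 4) ∧
      |gnoDeficit z χ a ε (gnoFibreEquiv (p, gnoScale p y)) - gnoDeficit z χ a ε (gnoBase p.1 p.2) -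
          deriv (fun t : ℝ => gnoDeficit z χ a ε (gnoBase p.1 p.2 + t • gnoFibreEmb (gnoScale p y))) 0 -
          iteratedDeriv 2 (fun t : ℝ => gnoDeficit z χ a ε (gnoBase p.1 p.2 + t • gnoFibreEmb (gnoScale p y))) 0 / 2| ≤ 2484000 * (L : ℝ) ^ 4 * ‖y‖ ^ 3 / 2 := by
  obtain ⟨hx, hy, hz, hf⟩ := letterSizes_rescaled_le p y
  have h := taylor_four_gnoDeficit z χ ha ε (gnoFibreEquiv (p, gnoScale p y)) (norm_nonneg y) hx hy hz hf
  have eray : (fun t : ℝ => gnoDeficit z χ a ε (eulerDilate t (gnoFibreEquiv (p, gnoScale p y)))) =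
      fun t : ℝ => gnoDeficit z χ a ε (gnoBase p.1 p.2 + t • gnoFibreEmb (gnoScale p y)) := funext fun t => by rw [gnoBase_add_smul_eq_eulerDilate]
  have e0 : eulerDilate 0 (gnoFibreEquiv (p, gnoScale p y)) = gnoBase p.1 p.2 := by
    rw [← gnoBase_add_smul_eq_eulerDilate, zero_smul, add_zero]
  rw [eray, e0] at h
  exact ⟨h.1, h.2.1⟩

/-- ★★ **THE RESCALED CUBIC DATUM AT THE FLAT BASE, UNIFORM IN `p`** (principal sector, `ε_z = +`, followers `+`):
`|F̂(gnoFibreEquiv (p, gnoScale p y)) − ½·fibQ a ε p (gnoScale p y)| ≤ 1242000L⁴‖y‖³` for EVERY `p ∈ ℝ²` and `y` (g47's `fibQ` = the ray second derivative;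
✓`gnoDeficit_base_eq_zero`, ✓`deriv_gnoDeficit_base_ray_eq_zero` kill the constant and linear terms). [cite: Luscher1983, §2] -/
theorem rescaled_cubic_flat {a : ℍ} (ha : a ≠ 0) (ε : GnoSign L) (hz : ε.2.1 = true) (hε : ε.2.2 = fun _ => true) (p : ℝ × ℝ) (y : GnoFibre L) :
    |gnoDeficit (fun _ => false) (fun _ => 1) a ε (gnoFibreEquiv (p, gnoScale p y)) - (1 / 2) * fibQ a ε p (gnoScale p y)| ≤ 1242000 * (L : ℝ) ^ 4 * ‖y‖ ^ 3 := by
  have h := (rescaled_ray_jets (fun _ => false) (fun _ => 1) ha ε p y).2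
  have h0 : gnoDeficit (fun _ => false) (fun _ => 1) a ε (gnoBase p.1 p.2) = 0 := gnoDeficit_base_eq_zero ha ε hz hε p.1 p.2
  have h1 : deriv (fun t : ℝ => gnoDeficit (fun _ => false) (fun _ => 1) a ε (gnoBase p.1 p.2 + t • gnoFibreEmb (gnoScale p y))) 0 = 0 :=
    deriv_gnoDeficit_base_ray_eq_zero ha ε hz hε p.1 p.2 _
  rw [h0, h1, sub_zero, sub_zero] at h
  unfold fibQ
  have e : (1 / 2 : ℝ) * iteratedDeriv 2 (fun s : ℝ => gnoDeficit z₀ (fun _ => 1) a ε (gnoBase p.1 p.2 + s • gnoFibreEmb (gnoScale p y))) 0 =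
      iteratedDeriv 2 (fun t : ℝ => gnoDeficit (fun _ => false) (fun _ => 1) a ε (gnoBase p.1 p.2 + t • gnoFibreEmb (gnoScale p y))) 0 / 2 := by
    rw [one_div, inv_mul_eq_div]
  rw [e]
  refine h.trans (le_of_eq ?_)
  ring

/-! ## §4 The rescaled amplitude: the density factorises -/

omit [NeZero L] in
/-- `gnomonicWeight (x₀, c·u₁, c·u₂) = gnomonicWeight (x₀, 0, 0) · gnomonicWeight (0, u₁, u₂)` for `c = √(1 + x₀²)`. [folklore] -/
theorem gnomonicWeight_rescaled (x₀ u₁ u₂ : ℝ) :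
    gnomonicWeight (![x₀, Real.sqrt (1 + x₀ ^ 2) * u₁, Real.sqrt (1 + x₀ ^ 2) * u₂] : Fin 3 → ℝ) =
      gnomonicWeight (![x₀, 0, 0] : Fin 3 → ℝ) * gnomonicWeight (![0, u₁, u₂] : Fin 3 → ℝ) := by
  have hc : Real.sqrt (1 + x₀ ^ 2) ^ 2 = 1 + x₀ ^ 2 := Real.sq_sqrt (by positivity)
  simp only [gnomonicWeight, normSq3, Fin.sum_univ_three, Matrix.cons_val_zero, Matrix.cons_val_one, Matrix.cons_val_two, Matrix.head_cons, Matrix.tail_cons]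
  rw [mul_pow, mul_pow, hc]
  have h1 : (0 : ℝ) < 1 + x₀ ^ 2 := by positivity
  have h2 : (0 : ℝ) < 1 + (u₁ ^ 2 + u₂ ^ 2) := by positivity
  field_simp
  ring

/-- ★★ **THE DENSITY FACTORISES IN THE RESCALED LETTERS**: `ρ(gnoFibreEquiv (p, gnoScale p y)) = ρ(gnoBase p)·ρ(gnoFibreEmb y)`. [folklore] -/
theorem gnoDensity_rescaled_eq (p : ℝ × ℝ) (y : GnoFibre L) :
    gnoDensity (gnoFibreEquiv (p, gnoScale p y)) = gnoDensity (gnoBase p.1 p.2 : GnoCoord L) * gnoDensity (gnoFibreEmb y) := by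
  rw [gnoFibreEquiv_apply', gnoFibreEmb_apply, gnoBase]
  simp only [gnoDensity, gnoScale_apply, gnoFibreScale, Sum.elim_inl, Sum.elim_inr, one_mul]
  rw [gnomonicWeight_rescaled, gnomonicWeight_rescaled]
  have hz0 : gnomonicWeight (0 : Fin 3 → ℝ) = 1 := by simp [gnomonicWeight, normSq3]
  have hF0 : piWeight (0 : Fol L → Fin 3 → ℝ) = 1 := by simp [piWeight, gnomonicWeight, normSq3]
  rw [hz0, hF0]
  ring

/-- `ρ(gnoFibreEmb y) ∈ [1 − 2‖y‖², 1]` (✓`gnoDensity_fibre_amplitude` at the base point `0`). [folklore] -/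
theorem gnoDensity_gnoFibreEmb_bounds (y : GnoFibre L) : 1 - 2 * ‖y‖ ^ 2 ≤ gnoDensity (gnoFibreEmb y) ∧ gnoDensity (gnoFibreEmb y) ≤ 1 := by
  obtain ⟨e, he, h1, h2⟩ := gnoDensity_fibre_amplitude (L := L) ((0 : ℝ), (0 : ℝ)) y
  have hb0 : gnoDensity (gnoBase (0 : ℝ) (0 : ℝ) : GnoCoord L) = 1 := by
    simp [gnoBase, gnoDensity, gnomonicWeight, piWeight, normSq3, Fin.sum_univ_three]
  have hemb : gnoFibreEquiv (((0 : ℝ), (0 : ℝ)), y) = gnoFibreEmb y := by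
    rw [gnoFibreEquiv_apply]
    have : (gnoBase (0 : ℝ) (0 : ℝ) : GnoCoord L) = 0 := by
      rw [gnoBase]; refine Prod.ext (Prod.ext ?_ ?_) (Prod.ext rfl rfl) <;> (funext k; fin_cases k <;> rfl)
    rw [this, zero_add]
  rw [hemb, hb0, one_mul] at he
  constructor <;> nlinarith [he, h1, h2]

/-- The base density times the rescaling Jacobian: `ρ(gnoBase p)·(1+x₀²)(1+y₀²) = (1+x₀²)⁻¹(1+y₀²)⁻¹` — the INTEGRABLE base weight of the rescaled chart. [folklore] -/
theorem gnoDensity_gnoBase_mul_jacobian (p : ℝ × ℝ) :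
    gnoDensity (gnoBase p.1 p.2 : GnoCoord L) * ((1 + p.1 ^ 2) * (1 + p.2 ^ 2)) = (1 + p.1 ^ 2)⁻¹ * (1 + p.2 ^ 2)⁻¹ := by
  have hz0 : gnomonicWeight (0 : Fin 3 → ℝ) = 1 := by simp [gnomonicWeight, normSq3]
  have hF0 : piWeight (0 : Fol L → Fin 3 → ℝ) = 1 := by simp [piWeight, gnomonicWeight, normSq3]
  have hax : ∀ x₀ : ℝ, gnomonicWeight (![x₀, 0, 0] : Fin 3 → ℝ) = ((1 + x₀ ^ 2)⁻¹) ^ 2 := fun x₀ => by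
    simp [gnomonicWeight, normSq3, Fin.sum_univ_three]
  have e : gnoDensity (gnoBase p.1 p.2 : GnoCoord L) = ((1 + p.1 ^ 2)⁻¹) ^ 2 * ((1 + p.2 ^ 2)⁻¹) ^ 2 := by
    rw [gnoBase]; simp only [gnoDensity]; rw [hz0, hF0, mul_one, mul_one, hax, hax]
  have h1 : (1 : ℝ) + p.1 ^ 2 ≠ 0 := by positivity
  have h2 : (1 : ℝ) + p.2 ^ 2 ≠ 0 := by positivity
  rw [e]
  field_simp

end Summit.QuantumFields.YangMills.Theorems.SwapVirialDeficit.BlowUpRing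

end
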